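import Literature.Geometry.Kaehler.ComplexTorusLatticeGroupCohomologyAllDegrees
import Literature.Geometry.Kaehler.ComplexTorusHodgeClassesMaps
import HarnessLib

/-!
# `φ_n : Hⁿ(Λ, ℤ) ⥲ Hⁿ(X, ℤ)` is NATURAL in homomorphisms of complex tori
# (Lange 2023, §1.1.6 Ex. (13): "canonical"; Brown V §6: "`ψ` is a natural map of functors of `G`")

Layer `Literature/Geometry/Kaehler`, namespace `Literature.Geometry.Kaehler.ComplexTorus`; lane
`lit-hodgefound`, Layer A, seat p30 (gen 5), FILE 3 of row «Q331⁺ · A1-06⁺⁺» (the all-degrees `φ_n`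
of `ComplexTorusLatticeGroupCohomologyAllDegrees`).  Definitions with bodies (`latticeHom`,
`trivialPairHom`, `groupCohomologyPullback`) and theorems; NO named fact.

For a homomorphism of complex tori `f_A : X = E/Φ(ℤ^ι) → X' = E'/Φ'(ℤ^ι')`, given as everywhere in the
lane by its rational representation `A : Matrix ι' ι ℤ` (`mapMatrix Φ Φ' A`, real analytic
representation `realRep Φ Φ' A : E →L[ℝ] E'`, `ComplexTorusMaps`; Lange 2023 §1.1.2 `ρ_r`, `ρ_a`):

* `latticeHom A : Λ →* Λ'` — `ρ_r(f_A)` on the multiplicatively written lattices, functorial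
  (`latticeHom_one`, `latticeHom_mul`); `trivialPairHom A` — the identity of `ℤ` over it;
  **`groupCohomologyPullback A n := groupCohomology.map (latticeHom A) (trivialPairHom A) n :
  Hⁿ(Λ', ℤ) → Hⁿ(Λ, ℤ)`** — `f_A^*` on Mathlib's group cohomology, a contravariant functor
  (`groupCohomologyPullback_one`, `groupCohomologyPullback_mul`) [Brown III §8].
* **`groupCohomologyForm_map`** (NATURALITY): `φ_n(f_A^* x) = (φ'_n x) ∘ realRep Φ Φ' A`, i.e. the square
  formed by `φ'_n : Hⁿ(Λ', ℤ) → Hⁿ(X', ℤ)`, `φ_n : Hⁿ(Λ, ℤ) → Hⁿ(X, ℤ)`, `f_A^*` on group cohomology and the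
  pullback `γ ↦ γ ∘ ρ_a(f_A)` of invariant forms (`comp_realRep_mem_integralForms`,
  `ComplexTorusHodgeClassesMaps`) commutes — proved from the lattice-period formula
  `φ_n[f](Φ m) = ⟨f, m₁ ∧ ⋯ ∧ mₙ⟩` and `realRep_comp_latticeTuple` (`ρ_a` maps lattice tuples to lattice
  tuples of `A m`); `coe_groupCohomologyEquiv_map`, and the transported form
  `groupCohomologyEquiv_symm_comp_realRep` : `φ_n⁻¹(f_A^* γ) = f_A^*(φ'_n⁻¹ γ)`.

This is the content of the word "canonical" in Lange's Exercise (13) [p0028] and of Brown's remark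
"it is an obvious but important fact that `ψ` is a natural map of functors of `G`" [V §6, p. 129].

## References
* H. Lange, *Abelian Varieties over the Complex Numbers* (2023), §1.1.2 (rational and analytic
  representations), §1.1.6 Exercise (13). [Lange2023AbelianVarietiesComplex]
* K. S. Brown, *Cohomology of Groups*, GTM 87 (1982), III §8 (functoriality, (8.1)–(8.3)), V §6 p. 129.
  [Brown1982CohomologyGroups]
-/

noncomputable section

open Function CategoryTheory groupCohomology Multiplicative

namespace Literature.Geometry.Kaehler

namespace ComplexTorus

open Literature.Algebra.Homology

section Group

variable {ι ι' : Type} [Fintype ι]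

-- The trivial `ℤ[Λ]`-modules `ℤ` of the two lattices.
local notation "𝓩Λ" => Rep.trivial ℤ (Multiplicative (ι → ℤ)) ℤ
local notation "𝓩Λ'" => Rep.trivial ℤ (Multiplicative (ι' → ℤ)) ℤ

/-- **The rational representation `ρ_r(f_A) : Λ → Λ'`, `m ↦ A m`,** of the homomorphism
`f_A = mapMatrix Φ Φ' A : X → X'` of complex tori, as a homomorphism of the (multiplicatively written)
lattice groups. [cite: Lange2023AbelianVarietiesComplex, §1.1.2] -/
def latticeHom (A : Matrix ι' ι ℤ) : Multiplicative (ι → ℤ) →* Multiplicative (ι' → ℤ) :=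
  AddMonoidHom.toMultiplicative (Matrix.mulVecLin A).toAddMonoidHom

/-- `ρ_r(f_A)(m) = A m`. [cite: Lange2023AbelianVarietiesComplex, §1.1.2] -/
@[simp]
theorem latticeHom_ofAdd (A : Matrix ι' ι ℤ) (m : ι → ℤ) : latticeHom A (ofAdd m) = ofAdd (A.mulVec m) :=
  rfl

/-- `ρ_r(id) = id`. [cite: Lange2023AbelianVarietiesComplex, §1.1.2] -/
theorem latticeHom_one [DecidableEq ι] : latticeHom (1 : Matrix ι ι ℤ) = MonoidHom.id _ :=
  MonoidHom.ext fun g => by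
    change ofAdd ((1 : Matrix ι ι ℤ).mulVec (toAdd g)) = g
    rw [Matrix.one_mulVec, ofAdd_toAdd]

/-- **`ρ_r(f_B ∘ f_A) = ρ_r(f_B) ∘ ρ_r(f_A)`** (`ρ_r` is a functor). [cite: Lange2023AbelianVarietiesComplex, §1.1.2] -/
theorem latticeHom_mul {ι'' : Type} [Fintype ι'] (B : Matrix ι'' ι' ℤ) (A : Matrix ι' ι ℤ) :
    latticeHom (B * A) = (latticeHom B).comp (latticeHom A) :=
  MonoidHom.ext fun g => by
    change ofAdd ((B * A).mulVec (toAdd g)) = ofAdd (B.mulVec (A.mulVec (toAdd g)))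
    rw [Matrix.mulVec_mulVec]

/-- The identity `ℤ → ℤ` as a morphism of trivial representations over `ρ_r(f_A)` (the coefficient
map of the pair `(ρ_r(f_A), id)`). [cite: Brown1982CohomologyGroups, III §8] -/
def trivialPairHom (A : Matrix ι' ι ℤ) : Rep.res (latticeHom A) 𝓩Λ' ⟶ 𝓩Λ :=
  Rep.ofHom (LinearMap.intertwiningMap_of_isIntertwiningMap _ _ LinearMap.id fun _ _ => rfl)

/-- **`f_A^* : Hⁿ(Λ', ℤ) → Hⁿ(Λ, ℤ)`**, the map induced on group cohomology by the pair
`(ρ_r(f_A), id_ℤ)` (Mathlib `groupCohomology.map`). [cite: Brown1982CohomologyGroups, III §8] -/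
abbrev groupCohomologyPullback (A : Matrix ι' ι ℤ) (n : ℕ) : groupCohomology 𝓩Λ' n ⟶ groupCohomology 𝓩Λ n :=
  groupCohomology.map (latticeHom A) (trivialPairHom A) n

/-- `id^* = 𝟙` on `Hⁿ(Λ, ℤ)`. [cite: Brown1982CohomologyGroups, III §8] -/
theorem groupCohomologyPullback_one [DecidableEq ι] (n : ℕ) :
    groupCohomologyPullback (1 : Matrix ι ι ℤ) n = 𝟙 (groupCohomology 𝓩Λ n) := by
  rw [groupCohomologyPullback, groupCohomology.map_congr (g := MonoidHom.id _) (ψ := 𝟙 𝓩Λ) latticeHom_one rfl n,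
    groupCohomology.map_id]

/-- **`(f_B ∘ f_A)^* = f_A^* ∘ f_B^*` on group cohomology** (contravariant functoriality of `Hⁿ(−, ℤ)`).
[cite: Brown1982CohomologyGroups, III §8] -/
theorem groupCohomologyPullback_mul {ι'' : Type} [Fintype ι'] (B : Matrix ι'' ι' ℤ) (A : Matrix ι' ι ℤ) (n : ℕ) :
    groupCohomologyPullback (ι := ι) (B * A) n =
      groupCohomologyPullback (ι := ι') B n ≫ groupCohomologyPullback A n := by
  rw [groupCohomologyPullback, groupCohomologyPullback, groupCohomologyPullback, ← groupCohomology.map_comp]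
  exact groupCohomology.map_congr (latticeHom_mul B A) rfl n

/-- On cochains the pair acts by `x ↦ x ∘ ρⁿ`. [cite: Brown1982CohomologyGroups, III §8] -/
private theorem cochainsMap_latticeHom_apply (A : Matrix ι' ι ℤ) (n : ℕ)
    (x : (Fin n → Multiplicative (ι' → ℤ)) → ℤ) (g : Fin n → Multiplicative (ι → ℤ)) :
    (cochainsMap (latticeHom A) (trivialPairHom A)).f n x g = x (latticeHom A ∘ g) := by
  rw [cochainsMap_f]
  rfl

/-- The cochain of the pulled-back cocycle. [cite: Brown1982CohomologyGroups, III §8] -/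
private theorem iCocycles_cocyclesMap_latticeHom (A : Matrix ι' ι ℤ) (n : ℕ) (z : cocycles 𝓩Λ' n) :
    iCocycles 𝓩Λ n (cocyclesMap (latticeHom A) (trivialPairHom A) n z) =
      (cochainsMap (latticeHom A) (trivialPairHom A)).f n (iCocycles 𝓩Λ' n z) := by
  change ((cocyclesMap (latticeHom A) (trivialPairHom A) n) ≫ iCocycles 𝓩Λ n) z = _
  rw [HomologicalComplex.cyclesMap_i]
  rfl

/-- **The alternating pairing is natural**: `⟨ρ^* x, g⟩ = ⟨x, ρ ∘ g⟩`. [cite: Brown1982CohomologyGroups, V §6] -/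
private theorem altPairing_cochainsMap_latticeHom (A : Matrix ι' ι ℤ) (n : ℕ)
    (x : (Fin n → Multiplicative (ι' → ℤ)) → ℤ) (g : Fin n → Multiplicative (ι → ℤ)) :
    altPairing g ((cochainsMap (latticeHom A) (trivialPairHom A)).f n x) = altPairing (latticeHom A ∘ g) x := by
  rw [altPairing_apply, altPairing_apply]
  refine Finset.sum_congr rfl fun σ _ => ?_
  rw [cochainsMap_latticeHom_apply]
  rfl

end Group

section Naturality

variable {ι ι' : Type} [Fintype ι] [LinearOrder ι] [Fintype ι'] [LinearOrder ι']
  {E E' : Type*} [NormedAddCommGroup E] [NormedSpace ℂ E] [NormedAddCommGroup E'] [NormedSpace ℂ E']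
  (Φ : (ι → ℝ) ≃L[ℝ] E) (Φ' : (ι' → ℝ) ≃L[ℝ] E')

local notation "𝓩Λ" => Rep.trivial ℤ (Multiplicative (ι → ℤ)) ℤ
local notation "𝓩Λ'" => Rep.trivial ℤ (Multiplicative (ι' → ℤ)) ℤ

/-- **NATURALITY OF `φ_n`**: for a homomorphism of complex tori `f_A : X = E/Φ(ℤ^ι) → X' = E'/Φ'(ℤ^ι')`
with rational representation `A` and real analytic representation `realRep Φ Φ' A`, the square
`Hⁿ(Λ', ℤ) —φ'_n→ Hⁿ(X', ℤ)`, `Hⁿ(Λ, ℤ) —φ_n→ Hⁿ(X, ℤ)` commutes with the pullbacks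
`f_A^* = Hⁿ(ρ_r(f_A), id)` (group side) and `f_A^* γ = γ ∘ ρ_a(f_A)` (invariant forms):
`φ_n(f_A^* x) = (φ'_n x) ∘ realRep Φ Φ' A` — Lange's "canonical", Brown's "ψ is a natural map of
functors of `G`". [cite: Lange2023AbelianVarietiesComplex, §1.1.6 Exercise (13)]
[cite: Brown1982CohomologyGroups, V §6] -/
theorem groupCohomologyForm_map (A : Matrix ι' ι ℤ) (n : ℕ) (x : groupCohomology 𝓩Λ' n) :
    groupCohomologyForm Φ n (groupCohomologyPullback A n x) =
      (groupCohomologyForm Φ' n x).compContinuousLinearMap (realRep Φ Φ' A) := by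
  induction x using groupCohomology_induction_on with
  | h z =>
    refine form_eq_of_forall_latticeTuple Φ fun m => ?_
    rw [groupCohomologyPullback, groupCohomology.π_map_apply, groupCohomologyForm_π_apply_latticeTuple,
      ContinuousAlternatingMap.compContinuousLinearMap_apply, realRep_comp_latticeTuple,
      groupCohomologyForm_π_apply_latticeTuple, iCocycles_cocyclesMap_latticeHom, altPairing_cochainsMap_latticeHom]
    rfl

/-- The same for the equivalences `φ_n : Hⁿ(Λ, ℤ) ≃ integralForms Φ n` (underlying forms).
[cite: Lange2023AbelianVarietiesComplex, §1.1.6 Exercise (13)] -/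
theorem coe_groupCohomologyEquiv_map (A : Matrix ι' ι ℤ) (n : ℕ) (x : groupCohomology 𝓩Λ' n) :
    (groupCohomologyEquiv Φ n (groupCohomologyPullback A n x) : E [⋀^Fin n]→L[ℝ] ℂ) =
      (groupCohomologyEquiv Φ' n x : E' [⋀^Fin n]→L[ℝ] ℂ).compContinuousLinearMap (realRep Φ Φ' A) := by
  rw [coe_groupCohomologyEquiv Φ, coe_groupCohomologyEquiv Φ', groupCohomologyForm_map Φ Φ']

/-- **The pullback of integral classes corresponds to `Hⁿ(ρ_r(f), id)`**: transporting
`f_A^* : Hⁿ(X', ℤ) → Hⁿ(X, ℤ)`, `γ ↦ γ ∘ realRep Φ Φ' A` (which preserves integral classes,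
`comp_realRep_mem_integralForms`) through `φ'_n`, `φ_n` gives Mathlib's `groupCohomology.map` along the
rational representation. [cite: Lange2023AbelianVarietiesComplex, §1.1.6 Exercise (13)] -/
theorem groupCohomologyEquiv_symm_comp_realRep (A : Matrix ι' ι ℤ) (n : ℕ) (γ : integralForms Φ' n) :
    (groupCohomologyEquiv Φ n).symm
        ⟨(γ : E' [⋀^Fin n]→L[ℝ] ℂ).compContinuousLinearMap (realRep Φ Φ' A),
          comp_realRep_mem_integralForms Φ Φ' A γ.2⟩ =
      groupCohomologyPullback A n ((groupCohomologyEquiv Φ' n).symm γ) := by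
  rw [AddEquiv.symm_apply_eq]
  refine Subtype.ext ?_
  rw [coe_groupCohomologyEquiv_map Φ Φ', AddEquiv.apply_symm_apply]

end Naturality

end ComplexTorus

end Literature.Geometry.Kaehler

end
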